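import Literature.NumberTheory.GaloisRepresentations.WeilDelignePure
import HarnessLib

/-!
# Purity is invariant under Frobenius-semisimplification (Taylor–Yoshida 2007, Lemma 1.4 (1))

Topic `Literature/NumberTheory/GaloisRepresentations`; dot-notation extensions of the accepted
structure `WeilDeligneRep` and of `WeilDeligneRep.IsPure` (`WeilDelignePure`).

**What is reproduced.** R. Taylor, T. Yoshida, *Compatibility of local and global Langlands
correspondences*, J. Amer. Math. Soc. **20** (2007), 467–493 (arXiv:math/0412357), §1, p. 471,
Lemma 1.4 (1) (arXiv p. 5): "*`(V, r, N)` is pure if and only if `(V, r, N)^{F-ss}` is.*"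

**How it is rendered.**  `IsPure` is phrased through the GENERALISED eigenspaces of `r(φ)`
(`weightSpace`), and the Frobenius-semisimplification `r' = (ρ^{ss}, N)` of `r = (ρ, N)`
(`IsFrobSemisimplificationOf r' r`: same `N`, same inertia action, `ρ(w) = ρ'(w) + n_w` with
`n_w` nilpotent commuting with the semisimple `ρ'(w)`) has the same generalised eigenspaces at
`φ`: for commuting `s, n` with `n` nilpotent, `ker (s + n - α)^∞ = ker (s - α)^∞`
(`maxGenEigenspace_add_eq_of_commute`, binomial theorem).  Hence the weight spaces, and the
purity condition, of `r` and `r'` literally coincide (`IsFrobSemisimplificationOf.weightSpace_eq`,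
`IsFrobSemisimplificationOf.isPure_iff`).

References: Taylor–Yoshida, J. Amer. Math. Soc. 20 (2007), arXiv:math/0412357, §1, Lemma 1.4 (1)
[TaylorYoshida2007].
-/

noncomputable section

namespace Literature.NumberTheory.GaloisRepresentations

variable {F : Type*} [Field F] [ValuativeRel F] [TopologicalSpace F] [IsNonarchimedeanLocalField F]

open GaloisRepresentations.IsNonarchimedeanLocalField WeilGroup

namespace WeilDeligneRep

/-! ### Linear algebra: generalised eigenspaces of `s + n`, `n` nilpotent commuting with `s` -/

section LinearAlgebra

variable {K : Type*} [Field K] {E : Type*} [AddCommGroup E] [Module K E]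

/-- `ker (s - α)^∞ ⊆ ker (s + n - α)^∞` for `n` nilpotent commuting with `s`: if `(s - α)^k x = 0`
and `n^m = 0` then `(n + (s - α))^{k+m} x = 0` by the binomial theorem. [folklore] -/
theorem maxGenEigenspace_le_maxGenEigenspace_add_of_commute {s n : Module.End K E}
    (hc : Commute n s) (hn : IsNilpotent n) (α : K) :
    Module.End.maxGenEigenspace s α ≤ Module.End.maxGenEigenspace (s + n) α := by
  intro x hx
  rw [Module.End.mem_maxGenEigenspace] at hx ⊢
  obtain ⟨k, hk⟩ := hx
  obtain ⟨m, hm⟩ := hn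
  refine ⟨k + m, ?_⟩
  have hc' : Commute n (s - α • (1 : Module.End K E)) :=
    hc.sub_right ((Commute.one_right n).smul_right α)
  have e : s + n - α • (1 : Module.End K E) = n + (s - α • 1) := by abel
  rw [e, hc'.add_pow, LinearMap.sum_apply]
  refine Finset.sum_eq_zero fun i _ => ?_
  by_cases him : i ≤ m
  · obtain ⟨d, hd⟩ : ∃ d, k + m - i = d + k := ⟨m - i, by omega⟩
    rw [Module.End.mul_apply, Module.End.mul_apply, Module.End.natCast_apply, map_nsmul, hd,
      pow_add, Module.End.mul_apply, hk, map_zero, smul_zero, map_zero]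
  · obtain ⟨d, hd⟩ : ∃ d, i = d + m := ⟨i - m, by omega⟩
    rw [hd, pow_add, hm, mul_zero, zero_mul, zero_mul, LinearMap.zero_apply]

/-- **`ker (s + n - α)^∞ = ker (s - α)^∞`** for `n` nilpotent commuting with `s` (apply the
previous lemma to `(s, n)` and to `(s + n, -n)`). [folklore] -/
theorem maxGenEigenspace_add_eq_of_commute {s n : Module.End K E} (hc : Commute n s)
    (hn : IsNilpotent n) (α : K) :
    Module.End.maxGenEigenspace (s + n) α = Module.End.maxGenEigenspace s α := by
  refine le_antisymm ?_ (maxGenEigenspace_le_maxGenEigenspace_add_of_commute hc hn α)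
  have h := maxGenEigenspace_le_maxGenEigenspace_add_of_commute (s := s + n) (n := -n)
    ((hc.add_right (Commute.refl n)).neg_left) hn.neg α
  rwa [add_neg_cancel_right] at h

end LinearAlgebra

/-! ### Taylor–Yoshida, Lemma 1.4 (1) -/

variable {V : Type*} [AddCommGroup V] [Module ℂ V]

/-- A Weil–Deligne representation and its Frobenius-semisimplification have the SAME weight
spaces (`ρ(φ) = ρ'(φ) + n`, `n` nilpotent commuting with `ρ'(φ)`, does not change generalised
eigenspaces). [cite: TaylorYoshida2007, Lemma 1.4 (1)] -/
theorem IsFrobSemisimplificationOf.weightSpace_eq {r' r : WeilDeligneRep F ℂ V}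
    (h : r'.IsFrobSemisimplificationOf r) (φ : WeilGroup F) (k : ℝ) (j : ℤ) :
    r.weightSpace φ k j = r'.weightSpace φ k j := by
  obtain ⟨n, hn, hc, he⟩ := (h.2.2 φ).2
  unfold weightSpace
  simp_rw [he, maxGenEigenspace_add_eq_of_commute hc hn]

/-- **Taylor–Yoshida, Lemma 1.4 (1): `(V, r, N)` is pure if and only if `(V, r, N)^{F-ss}` is**
(same weight spaces, same `N`). [cite: TaylorYoshida2007, Lemma 1.4 (1)] -/
theorem IsFrobSemisimplificationOf.isPure_iff {r' r : WeilDeligneRep F ℂ V}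
    (h : r'.IsFrobSemisimplificationOf r) (φ : WeilGroup F) (k : ℝ) :
    r.IsPure φ k ↔ r'.IsPure φ k := by
  have hW : r.weightSpace φ k = r'.weightSpace φ k := funext fun j => h.weightSpace_eq φ k j
  unfold IsPure
  rw [hW, h.1]

end WeilDeligneRep

end Literature.NumberTheory.GaloisRepresentations

end
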